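import Summits.CriticalPhenomena.SAWScalingLimit.Theses.SAWConfRestriction
import Summits.CriticalPhenomena.SAWScalingLimit.Theses.SAWRestrictionRigidity
import Summits.CriticalPhenomena.SAWScalingLimit.Theses.SAWConePseudogroup
import Summits.CriticalPhenomena.SAWScalingLimit.Theorems.SAWConePseudogroupCovarianceUpgrade
import Summits.CriticalPhenomena.SAWScalingLimit.Theorems.SAWConePseudogroupLatticeSimilarityOfLimit
import Summits.CriticalPhenomena.SAWScalingLimit.Theorems.SAWConePseudogroupEndpointApproxExists
import Summits.CriticalPhenomena.SAWScalingLimit.Theorems.SAWRestrictionRigidityLimitExistsNecessity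
import Literature.Probability.RandomPlanarGeometry.SAWScalingLimitFamily
import Literature.Probability.RandomPlanarGeometry.ConformalRestrictionCovariance
import Literature.Probability.RandomPlanarGeometry.ZoomFlow
import HarnessLib

/-!
# Strategist sketch (crux-strategist s2, 2026-08-17) — crux `ConfCovLimit` (stmt-CriticalPhenomena-0771)

Lean companion of `STRATEGY-CENSUS.md`.  Everything here is PROVED (no `sorry`); it certifies the
claims the census makes about the split `ConfCovLimit ⟸ LimitExists ∧ ConfCovOfLimit`:

* §1 the two children (bodies exactly as filed) and the glue / losslessness (duplicated from
  `ConfCovLimitSplit.lean`, which is the light-import landable version);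
* §2 NECESSITY: both children, hence the crux, follow from the summit conjunct `SAWScalingLimit`
  (`confCovOfLimit_of_sawScalingLimit`, `confCovLimit_of_sawScalingLimit`) — so no refutation of the
  crux or of either child exists short of `¬ SAWScalingLimit` (`not_sawScalingLimit_of_not_confCovLimit`);
* §3 BRIDGES: child 2 (`ConfCovOfLimit`, new item) is the common consequence node of the sibling
  covariance-upgrade routes — by-name implications from `SAWConePseudogroup`'s cruxes (over its LANDED
  glue `covarianceUpgrade_proof`, `latticeSimilarityOfLimit_proof`, `EndpointApproxExists_proof`) and from
  `SAWRestrictionRigidity`'s `Rigidity ∧ AxiomsOfLimit` (pure logic);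
* §4 WHAT IS ALREADY PROVED OF (conf): every scaling-limit family is covariant under the lattice
  similarities `z ↦ r·iᵏ·z + w` (`LatticeSimilarityOfLimit.cov_similarity`, landed), so the residual
  content of child 2 is (a) ISOTROPY (rotations by unimodular `c ∉ i^ℕ`) and (b) the SIMILARITY → CONFORMAL
  upgrade of the SAW limit; the typed second-generation cut `ConfCovOfLimit ⟸ IsotropyOfLimit ∧
  SimilarityToConformalOfLimit` with its glue and converses, and `IsotropyOfLimit ⟸ RotationOfLimit`
  (unit rotations about 0 suffice, by composing with the landed lattice part);
* §5 NEGATION typed: `¬ ConfCovLimit ↔ ¬ LimitExists ∨ (LimitExists ∧ ¬ ConfCovOfLimit)`; an anisotropic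
  scaling limit refutes child 2 and the summit;
* §6 the existence-side alternative cut available ON THIS ROUTE: `LimitExists ⟸ LimitExistsSome ∧
  EndpointRobust` (EndpointRobust = support item stmt-0776 of SAWConfRestriction), proved.
-/

noncomputable section

open MeasureTheory Filter Topology Set
open Literature.Probability.RandomPlanarGeometry Literature.Probability.RandomPlanarGeometry.SAW
open Literature.Probability.LatticeModels
open scoped NNReal ENNReal

namespace Summit.CriticalPhenomena.SAWScalingLimit.Cruxes.ConfCovLimit.StrategistS2

/-! ## §1 The split (children bodies exactly as filed on route SAWConfRestriction) -/

/-- Child 1 (dedup: byte-identical to stmt-CriticalPhenomena-1371 `SAWRestrictionRigidity.LimitExists`). -/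
def LimitExists : Prop :=
  ∃ P : Literature.Probability.RandomPlanarGeometry.ChordalFamily, P.IsChordal ∧ (∀ (D : Literature.Probability.RandomPlanarGeometry.DobrushinDomain) (a b : ℝ → Literature.Probability.LatticeModels.Site 2), Literature.Probability.RandomPlanarGeometry.SAW.IsEndpointApprox D a b → Literature.Probability.RandomPlanarGeometry.TendstoLaw (fun δ (γ : Literature.Probability.RandomPlanarGeometry.SAW.DomainSAW D.carrier δ (a δ) (b δ)) => γ.curve) (fun δ => Literature.Probability.RandomPlanarGeometry.SAW.law D.carrier δ (a δ) (b δ)) id (P D))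

/-- Child 2 (new item; byte-identical to the registered stub `stub_confCovOfLimit` of `Lines/birth.lean`). -/
def ConfCovOfLimit : Prop :=
  ∀ P : Literature.Probability.RandomPlanarGeometry.ChordalFamily, P.IsChordal → (∀ (D : Literature.Probability.RandomPlanarGeometry.DobrushinDomain) (a b : ℝ → Literature.Probability.LatticeModels.Site 2), Literature.Probability.RandomPlanarGeometry.SAW.IsEndpointApprox D a b → Literature.Probability.RandomPlanarGeometry.TendstoLaw (fun δ (γ : Literature.Probability.RandomPlanarGeometry.SAW.DomainSAW D.carrier δ (a δ) (b δ)) => γ.curve) (fun δ => Literature.Probability.RandomPlanarGeometry.SAW.law D.carrier δ (a δ) (b δ)) id (P D)) → P.IsConformallyCovariant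

theorem limitExists_iff_item1371 :
    LimitExists ↔ Summit.CriticalPhenomena.SAWScalingLimit.Theses.SAWRestrictionRigidity.LimitExists :=
  Iff.rfl

theorem limitExists_iff_cone :
    LimitExists ↔ Summit.CriticalPhenomena.SAWScalingLimit.Theses.SAWConePseudogroup.LimitExists :=
  Iff.rfl

theorem limitExists_iff_family : LimitExists ↔ ∃ P : ChordalFamily, SAW.IsScalingLimitFamily P :=
  ⟨fun ⟨P, h1, h2⟩ => ⟨P, ⟨h1, h2⟩⟩, fun ⟨P, ⟨h1, h2⟩⟩ => ⟨P, h1, h2⟩⟩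

theorem confCovOfLimit_iff_family :
    ConfCovOfLimit ↔ ∀ P : ChordalFamily, SAW.IsScalingLimitFamily P → P.IsConformallyCovariant :=
  ⟨fun h P hP => h P hP.1 hP.2, fun h P h1 h2 => h P ⟨h1, h2⟩⟩

/-- Glue: the parent BY NAME from the children. -/
theorem confCovLimit_of_parts (hE : LimitExists) (hC : ConfCovOfLimit) :
    Summit.CriticalPhenomena.SAWScalingLimit.Theses.SAWConfRestriction.ConfCovLimit := by
  obtain ⟨P, hch, hlim⟩ := hE
  exact ⟨P, hch, hlim, (ChordalFamily.isConformallyCovariant_iff P).1 (hC P hch hlim)⟩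

theorem limitExists_of_confCovLimit
    (h : Summit.CriticalPhenomena.SAWScalingLimit.Theses.SAWConfRestriction.ConfCovLimit) :
    LimitExists := by
  obtain ⟨P, hch, hlim, -⟩ := h
  exact ⟨P, hch, hlim⟩

theorem confCovOfLimit_of_confCovLimit
    (h : Summit.CriticalPhenomena.SAWScalingLimit.Theses.SAWConfRestriction.ConfCovLimit) :
    ConfCovOfLimit := by
  obtain ⟨P₀, hch, hlim, hconf⟩ := h
  intro P hPch hPlim
  have h₀ : SAW.IsScalingLimitFamily P₀ := ⟨hch, hlim⟩
  have hP : SAW.IsScalingLimitFamily P := ⟨hPch, hPlim⟩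
  rw [hP.unique h₀]
  exact (ChordalFamily.isConformallyCovariant_iff P₀).2 hconf

theorem confCovLimit_iff_parts :
    Summit.CriticalPhenomena.SAWScalingLimit.Theses.SAWConfRestriction.ConfCovLimit ↔
      LimitExists ∧ ConfCovOfLimit :=
  ⟨fun h => ⟨limitExists_of_confCovLimit h, confCovOfLimit_of_confCovLimit h⟩,
    fun h => confCovLimit_of_parts h.1 h.2⟩

/-! ## §2 Necessity: both children follow from the summit conjunct -/

/-- **Child 2 is summit-implied**: under `SAWScalingLimit`, every scaling-limit family IS the family
of chordal SLE_{8/3} laws (`IsScalingLimitFamily.isSLELaw_of_sawScalingLimit`, with existence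
`exists_isSLECurve_eightThirds` and uniqueness in law `IsSLECurve.map_eq_holds`, all theorems of the
tree), and a family of SLE_κ laws is conformally covariant (`ChordalFamily.isConformallyCovariant_of_isSLELaw`,
Lawler 2005 §6.1). [cite: Lawler2005, §6.1 p. 149] -/
theorem confCovOfLimit_of_sawScalingLimit (h : _root_.SAWScalingLimit) : ConfCovOfLimit := by
  classical
  haveI : Fact Literature.Probability.Process.isProjectiveLimit_preWienerMeasure :=
    ⟨isProjectiveLimit_preWienerMeasure_holds⟩
  choose Γ hΓ using fun D : DobrushinDomain => exists_isSLECurve_eightThirds D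
  have hSLE : ∀ D : DobrushinDomain, IsSLELaw ((8 : ℝ≥0) / 3) D
      (Literature.Probability.Process.preWienerMeasure.map (Γ D)) := fun D => ⟨Γ D, hΓ D, rfl⟩
  have hQ : ChordalFamily.IsChordal
      (fun D => Literature.Probability.Process.preWienerMeasure.map (Γ D)) := fun D =>
    ⟨(hSLE D).isProbabilityMeasure,
      (hSLE D).ae_endpoints JordanDomain.mapsTo_boundaryExtension_holds⟩
  intro P hch hlim
  have hP : SAW.IsScalingLimitFamily P := ⟨hch, hlim⟩
  exact ChordalFamily.isConformallyCovariant_of_isSLELaw fun D =>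
    hP.isSLELaw_of_sawScalingLimit IsSLECurve.map_eq_holds h hQ hSLE D

/-- **Child 1 is summit-implied** (landed: `limitExists_of_sawScalingLimit`, p145874). -/
theorem limitExists_of_sawScalingLimit (h : _root_.SAWScalingLimit) : LimitExists :=
  Summit.CriticalPhenomena.SAWScalingLimit.Theorems.SAWRestrictionRigidityLimitExists.limitExists_of_sawScalingLimit h

/-- **The crux itself is summit-implied** (`S → ConfCovLimit`; BC2-type record: the converse probe
`ConfCovLimit → S` needs restriction + simplicity + LSW03 and is the route). [folklore] -/
theorem confCovLimit_of_sawScalingLimit (h : _root_.SAWScalingLimit) :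
    Summit.CriticalPhenomena.SAWScalingLimit.Theses.SAWConfRestriction.ConfCovLimit :=
  confCovLimit_of_parts (limitExists_of_sawScalingLimit h) (confCovOfLimit_of_sawScalingLimit h)

/-- Hence: no refutation of the crux short of refuting the conjunct. [folklore] -/
theorem not_sawScalingLimit_of_not_confCovLimit
    (h : ¬ Summit.CriticalPhenomena.SAWScalingLimit.Theses.SAWConfRestriction.ConfCovLimit) :
    ¬ _root_.SAWScalingLimit :=
  fun hS => h (confCovLimit_of_sawScalingLimit hS)

theorem not_sawScalingLimit_of_not_confCovOfLimit (h : ¬ ConfCovOfLimit) : ¬ _root_.SAWScalingLimit :=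
  fun hS => h (confCovOfLimit_of_sawScalingLimit hS)

/-! ## §3 Bridges: child 2 is the common consequence node of the sibling upgrade routes -/

/-- **Cone bridge** (route SAWConePseudogroup): its three open cruxes `PowerMapUniversality` (7303),
`PseudogroupDensity` (7304), `ContinuityOfLimit` (7305) give child 2, over the route's LANDED glue
`covarianceUpgrade_proof` (7307), `latticeSimilarityOfLimit_proof` (7306) and `EndpointApproxExists_proof`
(4455). [folklore] -/
theorem confCovOfLimit_of_cone
    (hPM : Summit.CriticalPhenomena.SAWScalingLimit.Theses.SAWConePseudogroup.PowerMapUniversality)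
    (hPD : Summit.CriticalPhenomena.SAWScalingLimit.Theses.SAWConePseudogroup.PseudogroupDensity)
    (hCont : Summit.CriticalPhenomena.SAWScalingLimit.Theses.SAWConePseudogroup.ContinuityOfLimit) :
    ConfCovOfLimit := by
  intro P hch hlim
  exact Summit.CriticalPhenomena.SAWScalingLimit.Theorems.covarianceUpgrade_proof
    Summit.CriticalPhenomena.SAWScalingLimit.Theorems.EndpointApproxExists_proof hPM hPD P hch hlim
    (Summit.CriticalPhenomena.SAWScalingLimit.Theorems.latticeSimilarityOfLimit_proof
      Summit.CriticalPhenomena.SAWScalingLimit.Theorems.EndpointApproxExists_proof P hch hlim)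
    (hCont P hch hlim)

/-- **R\* bridge** (route SAWRestrictionRigidity): `Rigidity` (1368) and `AxiomsOfLimit` (1370) give
child 2 (pure logic). [folklore] -/
theorem confCovOfLimit_of_rigidity
    (hR : Summit.CriticalPhenomena.SAWScalingLimit.Theses.SAWRestrictionRigidity.Rigidity)
    (hA : Summit.CriticalPhenomena.SAWScalingLimit.Theses.SAWRestrictionRigidity.AxiomsOfLimit) :
    ConfCovOfLimit := by
  intro P hch hlim
  obtain ⟨hres, hmk, hrev, hsim, hconj, hsimple⟩ := hA P hch hlim
  exact hR P hch hres hmk hrev hsim hconj hsimple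

/-- So route SAWConePseudogroup's lattice+continuum cruxes close the parent crux of SAWConfRestriction
through the split. [folklore] -/
theorem confCovLimit_of_cone
    (hE : Summit.CriticalPhenomena.SAWScalingLimit.Theses.SAWConePseudogroup.LimitExists)
    (hPM : Summit.CriticalPhenomena.SAWScalingLimit.Theses.SAWConePseudogroup.PowerMapUniversality)
    (hPD : Summit.CriticalPhenomena.SAWScalingLimit.Theses.SAWConePseudogroup.PseudogroupDensity)
    (hCont : Summit.CriticalPhenomena.SAWScalingLimit.Theses.SAWConePseudogroup.ContinuityOfLimit) :
    Summit.CriticalPhenomena.SAWScalingLimit.Theses.SAWConfRestriction.ConfCovLimit :=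
  confCovLimit_of_parts hE (confCovOfLimit_of_cone hPM hPD hCont)

/-! ## §4 What is already proved of (conf), and the typed second-generation cut of child 2 -/

/-- **Landed**: every scaling-limit family is covariant under the lattice similarities
`z ↦ r·iᵏ·z + w` (`r > 0`, `k ∈ ℕ`, `w ∈ ℂ`) — quarter turns exact at each mesh, dilations via
`(λΩ)_δ = λΩ_{δ/λ}` and the full-filter limit, translations along `δₙ = |w|/(n+1)`.
(`LatticeSimilarityOfLimit.cov_similarity`, route SAWConePseudogroup, stmt-7306 proved.) [folklore] -/
theorem latticeSimilarity_of_limit {P : ChordalFamily} (hP : SAW.IsScalingLimitFamily P)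
    (D : DobrushinDomain) (c : ℂ) (hc : c ≠ 0) (w : ℂ)
    (hcm : ∃ (r : ℝ) (k : ℕ), 0 < r ∧ c = (r : ℂ) * Complex.I ^ k) :
    P (D.map (similarity c hc w)) = (P D).map (CurveClass.map (similarity c hc w : C(ℂ, ℂ))) :=
  Summit.CriticalPhenomena.SAWScalingLimit.Theorems.LatticeSimilarityOfLimit.cov_similarity hP D c hc w hcm

/-- **(a) ISOTROPY of the SAW limit**: every scaling-limit family is covariant under ALL plane
similarities `z ↦ c z + w` (`ChordalFamily.IsSimilarityCovariant`), i.e. also under rotations by angles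
`∉ (π/2)ℤ`.  Open (Duminil-Copin–Kozlowski–Krachun–Manolescu–Oulamara arXiv:2012.11672 prove rotation
invariance for FK percolation `q ∈ [1,4]` via Yang–Baxter; the vertex SAW on `ℤ²` has no Yang–Baxter
representation — barrier `NienhuisWeightsExcludeVertexSAW`). -/
def IsotropyOfLimit : Prop :=
  ∀ P : Literature.Probability.RandomPlanarGeometry.ChordalFamily, P.IsChordal → (∀ (D : Literature.Probability.RandomPlanarGeometry.DobrushinDomain) (a b : ℝ → Literature.Probability.LatticeModels.Site 2), Literature.Probability.RandomPlanarGeometry.SAW.IsEndpointApprox D a b → Literature.Probability.RandomPlanarGeometry.TendstoLaw (fun δ (γ : Literature.Probability.RandomPlanarGeometry.SAW.DomainSAW D.carrier δ (a δ) (b δ)) => γ.curve) (fun δ => Literature.Probability.RandomPlanarGeometry.SAW.law D.carrier δ (a δ) (b δ)) id (P D)) → P.IsSimilarityCovariant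

/-- **(b) SIMILARITY ⇒ CONFORMAL for the SAW limit**: a scaling-limit family that is similarity
covariant is conformally covariant.  Kept RELATIVE to (lim): the model-blind version
`∀ P chordal, IsSimilarityCovariant → IsConformallyCovariant` is false (Dirac mass on the Euclidean
geodesic chord; cf. the refuted `not_SymmetryUpgrade`, stmt-0698, fat-germ surgery) and the correlation
version is the barrier `ScaleCovarianceNotMoebius`; at `c = 0` even the physics upgrade
(Zamolodchikov–Polchinski) is unavailable (barrier `SAWNoUnitaryCFT`; Riva–Cardy 2005). -/
def SimilarityToConformalOfLimit : Prop :=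
  ∀ P : Literature.Probability.RandomPlanarGeometry.ChordalFamily, P.IsChordal → (∀ (D : Literature.Probability.RandomPlanarGeometry.DobrushinDomain) (a b : ℝ → Literature.Probability.LatticeModels.Site 2), Literature.Probability.RandomPlanarGeometry.SAW.IsEndpointApprox D a b → Literature.Probability.RandomPlanarGeometry.TendstoLaw (fun δ (γ : Literature.Probability.RandomPlanarGeometry.SAW.DomainSAW D.carrier δ (a δ) (b δ)) => γ.curve) (fun δ => Literature.Probability.RandomPlanarGeometry.SAW.law D.carrier δ (a δ) (b δ)) id (P D)) → P.IsSimilarityCovariant → P.IsConformallyCovariant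

/-- Glue of the second-generation cut. [folklore] -/
theorem confCovOfLimit_of_isotropy_of_upgrade (hI : IsotropyOfLimit)
    (hU : SimilarityToConformalOfLimit) : ConfCovOfLimit :=
  fun P hch hlim => hU P hch hlim (hI P hch hlim)

/-- Converse: child 2 gives isotropy (conformal ⇒ similarity covariance, landed
`IsConformallyCovariant.isSimilarityCovariant`). [folklore] -/
theorem isotropyOfLimit_of_confCovOfLimit (h : ConfCovOfLimit) : IsotropyOfLimit :=
  fun P hch hlim => (h P hch hlim).isSimilarityCovariant

/-- Converse: child 2 gives the upgrade clause trivially. [folklore] -/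
theorem similarityToConformal_of_confCovOfLimit (h : ConfCovOfLimit) : SimilarityToConformalOfLimit :=
  fun P hch hlim _ => h P hch hlim

/-- The second-generation cut is lossless too. [folklore] -/
theorem confCovOfLimit_iff_isotropy_and_upgrade :
    ConfCovOfLimit ↔ IsotropyOfLimit ∧ SimilarityToConformalOfLimit :=
  ⟨fun h => ⟨isotropyOfLimit_of_confCovOfLimit h, similarityToConformal_of_confCovOfLimit h⟩,
    fun h => confCovOfLimit_of_isotropy_of_upgrade h.1 h.2⟩

/-- Both second-generation pieces are summit-implied (hence unrefutable short of `¬S`). [folklore] -/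
theorem isotropy_and_upgrade_of_sawScalingLimit (h : _root_.SAWScalingLimit) :
    IsotropyOfLimit ∧ SimilarityToConformalOfLimit :=
  confCovOfLimit_iff_isotropy_and_upgrade.1 (confCovOfLimit_of_sawScalingLimit h)

/-- **ROTATIONS ABOUT 0 BY UNIMODULAR `c` SUFFICE FOR ISOTROPY**: the residual of (a) after the landed
lattice part.  `RotationOfLimit`: every scaling-limit family is covariant under `z ↦ c z`, `‖c‖ = 1`. -/
def RotationOfLimit : Prop :=
  ∀ P : ChordalFamily, SAW.IsScalingLimitFamily P → ∀ (D : DobrushinDomain) (c : ℂ) (hc : c ≠ 0),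
    ‖c‖ = 1 → P (D.map (similarity c hc 0)) = (P D).map (CurveClass.map (similarity c hc 0 : C(ℂ, ℂ)))

/-- `IsotropyOfLimit ⟸ RotationOfLimit`: write `c z + w = 1·((c/‖c‖)·(‖c‖ z)) + w` and compose the
unit rotation (hypothesis) with the dilation by `‖c‖` and the translation by `w` (both LANDED instances of
`cov_similarity`, `r·i⁰`) via `ChordalFamily.covariant_trans`. [folklore] -/
theorem isotropyOfLimit_of_rotation (hR : RotationOfLimit) : IsotropyOfLimit := by
  intro P hch hlim D c hc w
  have hP : SAW.IsScalingLimitFamily P := ⟨hch, hlim⟩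
  have hn : (‖c‖ : ℂ) ≠ 0 := Complex.ofReal_ne_zero.2 (norm_ne_zero_iff.2 hc)
  have hu : c / (‖c‖ : ℂ) ≠ 0 := div_ne_zero hc hn
  have hunit : ‖c / (‖c‖ : ℂ)‖ = 1 := by
    rw [norm_div, Complex.norm_real, Real.norm_eq_abs, abs_norm, div_self (norm_ne_zero_iff.2 hc)]
  -- the three landed / assumed covariances
  have hdil : ∀ D : DobrushinDomain, P (D.map (similarity (‖c‖ : ℂ) hn 0)) =
      (P D).map (CurveClass.map (similarity (‖c‖ : ℂ) hn 0 : C(ℂ, ℂ))) := fun D =>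
    latticeSimilarity_of_limit hP D _ hn 0 ⟨‖c‖, 0, norm_pos_iff.2 hc, by simp⟩
  have hrot : ∀ D : DobrushinDomain, P (D.map (similarity (c / (‖c‖ : ℂ)) hu 0)) =
      (P D).map (CurveClass.map (similarity (c / (‖c‖ : ℂ)) hu 0 : C(ℂ, ℂ))) := fun D =>
    hR P hP D _ hu hunit
  have htr : ∀ D : DobrushinDomain, P (D.map (similarity 1 one_ne_zero w)) =
      (P D).map (CurveClass.map (similarity 1 one_ne_zero w : C(ℂ, ℂ))) := fun D =>
    latticeSimilarity_of_limit hP D 1 one_ne_zero w ⟨1, 0, one_pos, by simp⟩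
  -- compose
  have key : similarity c hc w =
      ((similarity (‖c‖ : ℂ) hn 0).trans (similarity (c / (‖c‖ : ℂ)) hu 0)).trans
        (similarity 1 one_ne_zero w) := by
    ext1 z
    simp only [Homeomorph.trans_apply, similarity_apply, add_zero, one_mul]
    rw [← mul_assoc, div_mul_cancel₀ c hn]
  rw [key]
  refine ChordalFamily.covariant_trans (CurveClass.measurable_map _)
    (measurable_curveClassMap_similarity _ _ _) (fun D => ?_) htr D
  exact ChordalFamily.covariant_trans (measurable_curveClassMap_similarity _ _ _)
    (measurable_curveClassMap_similarity _ _ _) hdil hrot D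

/-! ## §5 Negation, typed -/

/-- The only two ways the crux can fail. [folklore] -/
theorem not_confCovLimit_iff :
    ¬ Summit.CriticalPhenomena.SAWScalingLimit.Theses.SAWConfRestriction.ConfCovLimit ↔
      (¬ LimitExists ∨ (LimitExists ∧ ¬ ConfCovOfLimit)) := by
  rw [confCovLimit_iff_parts]
  by_cases hE : LimitExists <;> simp [hE]

/-- An ANISOTROPIC scaling limit: the SAW limit exists but is not covariant under some similarity
(necessarily a rotation by an angle `∉ (π/2)ℤ` composed with lattice similarities, by §4). -/
def AnisotropicLimit : Prop :=
  ∃ P : ChordalFamily, SAW.IsScalingLimitFamily P ∧ ¬ P.IsSimilarityCovariant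

/-- An anisotropic limit refutes child 2 (and isotropy), hence the summit — and nothing weaker than
the summit is refuted by it on the existence side (it ASSERTS `LimitExists`). [folklore] -/
theorem anisotropicLimit_refutes (h : AnisotropicLimit) :
    LimitExists ∧ ¬ ConfCovOfLimit ∧ ¬ _root_.SAWScalingLimit := by
  obtain ⟨P, hP, hnot⟩ := h
  have hC : ¬ ConfCovOfLimit := fun hC => hnot (hC P hP.1 hP.2).isSimilarityCovariant
  exact ⟨⟨P, hP.1, hP.2⟩, hC, not_sawScalingLimit_of_not_confCovOfLimit hC⟩

/-! ## §6 Existence-side cut available on THIS route: one convention per domain + EndpointRobust -/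

/-- `LimitExistsSome`: a chordal family that is the limit along SOME endpoint approximation per domain. -/
def LimitExistsSome : Prop :=
  ∃ P : ChordalFamily, P.IsChordal ∧ ∀ D : DobrushinDomain, ∃ a b : ℝ → Site 2,
    SAW.IsEndpointApprox D a b ∧
      TendstoLaw (fun δ (γ : DomainSAW D.carrier δ (a δ) (b δ)) => γ.curve)
        (fun δ => SAW.law D.carrier δ (a δ) (b δ)) id (P D)

/-- **`LimitExists ⟸ LimitExistsSome ∧ EndpointRobust`** (EndpointRobust = support item stmt-0776 of
route SAWConfRestriction: the difference of test integrals along two endpoint approximations of the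
same domain tends to `0`).  The cut isolates the "typed stronger than print" clause (ALL endpoint
approximations; Kennedy–Lawler boundary lattice effects) from the printed LSW/DCS conjecture (one
convention per domain). [cite: KennedyLawler2013, §1] -/
theorem limitExists_of_some_of_endpointRobust (h1 : LimitExistsSome)
    (h2 : Summit.CriticalPhenomena.SAWScalingLimit.Theses.SAWConfRestriction.EndpointRobust) :
    LimitExists := by
  obtain ⟨P, hch, hsome⟩ := h1
  refine ⟨P, hch, fun D a' b' hab' f => ?_⟩
  obtain ⟨a, b, hab, hT⟩ := hsome D
  have h := (hT f).sub (h2 D a b a' b' hab hab' f)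
  simp only [sub_sub_cancel, sub_zero] at h
  exact h

/-- Conversely `LimitExists → LimitExistsSome` (an endpoint approximation exists for every Dobrushin
domain, `SAW.exists_isEndpointApprox`). [folklore] -/
theorem limitExistsSome_of_limitExists (h : LimitExists) : LimitExistsSome := by
  obtain ⟨P, hch, hlim⟩ := h
  refine ⟨P, hch, fun D => ?_⟩
  obtain ⟨a, b, hab⟩ := SAW.exists_isEndpointApprox D
  exact ⟨a, b, hab, hlim D a b hab⟩

end Summit.CriticalPhenomena.SAWScalingLimit.Cruxes.ConfCovLimit.StrategistS2

end
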